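import Mathlib.Analysis.InnerProductSpace.PiL2
import Mathlib.Analysis.InnerProductSpace.Orthonormal
import Mathlib.Analysis.Normed.Module.FiniteDimension
import Mathlib.Topology.MetricSpace.Sequences
import HarnessLib

/-!
# A uniformly transverse member of a finite family of linear maps

Linear-algebraic compactness lemma used in the proof of Lelong's theorem on the locally finite
`𝓗^{2p}`-measure of complex analytic sets (`Literature/Geometry/Kaehler/HolomorphicChainFacts.lean`,
`Lelong1957_hausdorffMeasure_inter_lt_top`): the tangent planes of the regular part of a pure
`p`-dimensional analytic set are complex `p`-planes, each of which projects isomorphically onto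
SOME coordinate `p`-plane (`Literature.Geometry.Kaehler.SCV.exists_embedding_ker_coordProj_disjoint`,
[Chirka1989, §2.3 Prop. 2]); here we record that the norm of the inverse can be bounded UNIFORMLY
over all `p`-planes.

* `exists_uniform_bound_of_forall_exists_ker_inf_eq_bot` — let `V` be a finite-dimensional complex
  inner product space and `ℓ k : V → F` (`k` in a finite index type) continuous linear maps such
  that every `p`-dimensional subspace `T` meets the kernel of some `ℓ k` trivially. Then there
  is `C > 0` such that every `p`-dimensional `T` admits a `k` with `‖v‖ ≤ C ‖ℓ k v‖` for all
  `v ∈ T`. Proof: otherwise there are orthonormal `p`-frames `uₘ` and unit coefficient vectors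
  `cₘₖ ∈ ℂᵖ` with `‖ℓ k (Σ cₘₖᵢ uₘᵢ)‖ < ‖Σ cₘₖᵢ uₘᵢ‖ / (m + 1) ≤ p / (m + 1)`; orthonormal
  frames and unit vectors form compact sets, and at a limit point `(u, (c_k)_k)` every `ℓ k` kills
  the nonzero vector `Σ c_{k,i} uᵢ` of the `p`-plane spanned by `u` — a contradiction.

Theorems only; Mathlib-only imports.

## References

* E. M. Chirka, *Complex Analytic Sets*, Kluwer (1989), §2.3 Prop. 2 [Chirka1989].
-/

open scoped Topology
open Set Filter

namespace Literature.Geometry.Kaehler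

section Frames

variable {V : Type*} [NormedAddCommGroup V] [InnerProductSpace ℂ V]

/-- The vector `Σ cᵢ uᵢ` with coefficients `c ∈ ℂᵖ` on a frame `u`; continuous in `(u, c)`.
[folklore] -/
theorem continuous_frameCombination (p : ℕ) :
    Continuous fun q : (Fin p → V) × (Fin p → ℂ) => ∑ i, q.2 i • q.1 i := by
  refine continuous_finsetSum _ fun i _ => ?_
  exact ((continuous_apply i).comp continuous_snd).smul ((continuous_apply i).comp continuous_fst)

/-- On an orthonormal frame `u` and a coefficient vector `c` of sup-norm `≤ 1`,
`‖Σ cᵢ uᵢ‖ ≤ p`. [folklore] -/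
theorem norm_frameCombination_le {p : ℕ} {u : Fin p → V} (hu : Orthonormal ℂ u) {c : Fin p → ℂ}
    (hc : ‖c‖ ≤ 1) : ‖∑ i, c i • u i‖ ≤ p := by
  calc ‖∑ i, c i • u i‖ ≤ ∑ i, ‖c i • u i‖ := norm_sum_le _ _
    _ ≤ ∑ _i : Fin p, (1 : ℝ) := Finset.sum_le_sum fun i _ => by
        rw [norm_smul, hu.1 i, mul_one]
        exact (norm_le_pi_norm c i).trans hc
    _ = p := by simp

/-- A nonzero coefficient vector on an orthonormal frame gives a nonzero vector. [folklore] -/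
theorem frameCombination_ne_zero {p : ℕ} {u : Fin p → V} (hu : Orthonormal ℂ u) {c : Fin p → ℂ}
    (hc : c ≠ 0) : ∑ i, c i • u i ≠ 0 := by
  intro h0
  apply hc
  funext i
  exact Fintype.linearIndependent_iff.1 hu.linearIndependent c h0 i

/-- The set of orthonormal `p`-frames is closed. [folklore] -/
theorem isClosed_setOf_orthonormal (p : ℕ) : IsClosed {u : Fin p → V | Orthonormal ℂ u} := by
  have h : {u : Fin p → V | Orthonormal ℂ u} =
      ⋂ i : Fin p, ⋂ j : Fin p, {u | inner ℂ (u i) (u j) = if i = j then (1 : ℂ) else 0} := by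
    ext u
    simp only [mem_setOf_eq, mem_iInter, orthonormal_iff_ite]
  rw [h]
  refine isClosed_iInter fun i => isClosed_iInter fun j => ?_
  exact isClosed_eq (((continuous_apply i).inner (continuous_apply j))) continuous_const

/-- Orthonormal frames have sup-norm `≤ 1`. [folklore] -/
theorem norm_le_one_of_orthonormal {p : ℕ} {u : Fin p → V} (hu : Orthonormal ℂ u) : ‖u‖ ≤ 1 :=
  (pi_norm_le_iff_of_nonneg zero_le_one).2 fun i => (hu.1 i).le

variable [FiniteDimensional ℂ V]

/-- The set of orthonormal `p`-frames of a finite-dimensional inner product space is compact.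
[folklore] -/
theorem isCompact_setOf_orthonormal (p : ℕ) : IsCompact {u : Fin p → V | Orthonormal ℂ u} := by
  haveI : ProperSpace V := FiniteDimensional.proper_rclike ℂ V
  refine Metric.isCompact_of_isClosed_isBounded (isClosed_setOf_orthonormal p) ?_
  refine (Metric.isBounded_closedBall (x := (0 : Fin p → V)) (r := 1)).subset fun u hu => ?_
  rw [Metric.mem_closedBall, dist_zero_right]
  exact norm_le_one_of_orthonormal hu

/-- Every `p`-dimensional subspace is spanned by an orthonormal `p`-frame. [folklore] -/
theorem exists_orthonormal_span_eq {p : ℕ} (T : Submodule ℂ V) (hT : Module.finrank ℂ T = p) :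
    ∃ u : Fin p → V, Orthonormal ℂ u ∧ (∀ i, u i ∈ T) ∧
      ∀ v ∈ T, ∃ c : Fin p → ℂ, ∑ i, c i • u i = v := by
  set b : OrthonormalBasis (Fin p) ℂ T := (stdOrthonormalBasis ℂ T).reindex (finCongr hT) with hb
  refine ⟨fun i => (b i : V), ?_, fun i => (b i).2, fun v hv => ?_⟩
  · have h := b.orthonormal
    exact (T.subtypeₗᵢ.orthonormal_comp_iff).2 h
  · obtain ⟨c, hc⟩ : ∃ c : Fin p → ℂ, ∑ i, c i • b i = ⟨v, hv⟩ := by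
      refine ⟨fun i => b.repr ⟨v, hv⟩ i, ?_⟩
      exact b.sum_repr ⟨v, hv⟩
    refine ⟨c, ?_⟩
    have := congrArg (Subtype.val : T → V) hc
    simpa using this

end Frames

/-- **Uniform transversality.** Let `V` be a finite-dimensional complex inner product space and
`ℓ k : V → F`, `k ∈ κ` finite, continuous linear maps such that every `p`-dimensional subspace `T`
satisfies `ker (ℓ k) ⊓ T = ⊥` for some `k`. Then there is `C > 0` such that for every
`p`-dimensional `T` some `ℓ k` satisfies `‖v‖ ≤ C ‖ℓ k v‖` on `T` (compactness of orthonormal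
frames and of the unit sphere of `ℂᵖ`). [folklore] -/
theorem exists_uniform_bound_of_forall_exists_ker_inf_eq_bot
    {V : Type*} [NormedAddCommGroup V] [InnerProductSpace ℂ V] [FiniteDimensional ℂ V]
    {F : Type*} [NormedAddCommGroup F] [NormedSpace ℂ F]
    {κ : Type*} [Fintype κ] (ℓ : κ → V →L[ℂ] F) {p : ℕ}
    (h : ∀ T : Submodule ℂ V, Module.finrank ℂ T = p →
      ∃ k, LinearMap.ker (ℓ k : V →ₗ[ℂ] F) ⊓ T = ⊥) :
    ∃ C : ℝ, 0 < C ∧ ∀ T : Submodule ℂ V, Module.finrank ℂ T = p →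
      ∃ k, ∀ v ∈ T, ‖v‖ ≤ C * ‖ℓ k v‖ := by
  classical
  by_contra H
  push Not at H
  -- for every `m`, a bad `p`-plane `T m` with bad vectors for every `k`
  have H' : ∀ m : ℕ, ∃ T : Submodule ℂ V, Module.finrank ℂ T = p ∧
      ∀ k, ∃ v ∈ T, (m + 1 : ℝ) * ‖ℓ k v‖ < ‖v‖ := fun m =>
    H (m + 1) (by positivity)
  choose T hT hbad using H'
  choose v hvT hv using hbad
  -- orthonormal frames of the `T m` and normalised coefficient vectors
  choose u hu huT hspan using fun m => exists_orthonormal_span_eq (T m) (hT m)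
  have hcoef : ∀ (m : ℕ) (k : κ), ∃ c : Fin p → ℂ, ‖c‖ = 1 ∧
      (m + 1 : ℝ) * ‖ℓ k (∑ i, c i • u m i)‖ < ‖∑ i, c i • u m i‖ := by
    intro m k
    obtain ⟨c, hc⟩ := hspan m (v m k) (hvT m k)
    have hv0 : v m k ≠ 0 := by
      intro h0
      have := hv m k
      rw [h0, norm_zero] at this
      exact absurd this (not_lt.2 (by positivity))
    have hc0 : c ≠ 0 := by
      rintro rfl
      apply hv0
      rw [← hc]
      simp
    have hcn : 0 < ‖c‖ := norm_pos_iff.2 hc0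
    refine ⟨((‖c‖ : ℂ)⁻¹) • c, by
      rw [norm_smul, norm_inv, Complex.norm_real, norm_norm, inv_mul_cancel₀ hcn.ne'], ?_⟩
    have hsum : ∑ i, (((‖c‖ : ℂ)⁻¹) • c) i • u m i = ((‖c‖ : ℂ)⁻¹) • ∑ i, c i • u m i := by
      rw [Finset.smul_sum]
      refine Finset.sum_congr rfl fun i _ => ?_
      rw [Pi.smul_apply, smul_eq_mul, mul_smul]
    rw [hsum, hc, map_smul, norm_smul, norm_smul, ← mul_assoc, mul_comm (m + 1 : ℝ), mul_assoc]
    have hpos : 0 < ‖((‖c‖ : ℂ)⁻¹)‖ := by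
      rw [norm_inv, Complex.norm_real, norm_norm]
      exact inv_pos.2 hcn
    exact mul_lt_mul_of_pos_left (hv m k) hpos
  choose c hc1 hclt using hcoef
  -- the compact set of data and the sequence in it
  set S : Set ((Fin p → V) × (κ → Fin p → ℂ)) :=
    {u | Orthonormal ℂ u} ×ˢ Set.pi univ fun _ => Metric.sphere (0 : Fin p → ℂ) 1 with hS
  have hSc : IsCompact S :=
    (isCompact_setOf_orthonormal p).prod (isCompact_univ_pi fun _ => isCompact_sphere _ _)
  set z : ℕ → (Fin p → V) × (κ → Fin p → ℂ) := fun m => (u m, fun k => c m k) with hz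
  have hzS : ∀ m, z m ∈ S := fun m =>
    ⟨hu m, fun k _ => by simpa [Metric.mem_sphere, dist_zero_right] using hc1 m k⟩
  obtain ⟨q, hqS, φ, hφ, hlim⟩ := hSc.tendsto_subseq hzS
  obtain ⟨hqu, hqc⟩ := hqS
  -- at the limit every `ℓ k` kills the vector with coefficients `q.2 k` on the frame `q.1`
  have hkill : ∀ k, ℓ k (∑ i, q.2 k i • q.1 i) = 0 := by
    intro k
    have hcont : Continuous fun w : (Fin p → V) × (κ → Fin p → ℂ) =>
        ‖ℓ k (∑ i, w.2 k i • w.1 i)‖ := by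
      refine ((ℓ k).continuous.comp ?_).norm
      have h1 : Continuous fun w : (Fin p → V) × (κ → Fin p → ℂ) => (w.1, w.2 k) :=
        continuous_fst.prodMk ((continuous_apply k).comp continuous_snd)
      exact (continuous_frameCombination p).comp h1
    have hconv : Tendsto (fun m => ‖ℓ k (∑ i, (z (φ m)).2 k i • (z (φ m)).1 i)‖) atTop
        (𝓝 ‖ℓ k (∑ i, q.2 k i • q.1 i)‖) :=
      (hcont.tendsto q).comp hlim
    -- the same sequence tends to `0`
    have hbound : ∀ m, ‖ℓ k (∑ i, (z (φ m)).2 k i • (z (φ m)).1 i)‖ ≤ p / (φ m + 1 : ℝ) := by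
      intro m
      have h1 := hclt (φ m) k
      have h2 : ‖∑ i, c (φ m) k i • u (φ m) i‖ ≤ p :=
        norm_frameCombination_le (hu (φ m)) (hc1 (φ m) k).le
      have hpos : (0 : ℝ) < φ m + 1 := by positivity
      rw [le_div_iff₀ hpos, mul_comm]
      exact (h1.le.trans h2)
    have hzero : Tendsto (fun m => ‖ℓ k (∑ i, (z (φ m)).2 k i • (z (φ m)).1 i)‖) atTop (𝓝 0) := by
      refine squeeze_zero (fun m => norm_nonneg _) hbound ?_
      have hφt : Tendsto (fun m => (φ m : ℝ) + 1) atTop atTop := by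
        have : Tendsto (fun m => (φ m : ℝ)) atTop atTop :=
          tendsto_natCast_atTop_atTop.comp hφ.tendsto_atTop
        exact tendsto_atTop_add_const_right _ 1 this
      simpa using (tendsto_const_nhds (x := (p : ℝ))).div_atTop hφt
    have := tendsto_nhds_unique hconv hzero
    exact norm_eq_zero.1 this
  -- the `p`-plane spanned by the limit frame contradicts the hypothesis
  set T₀ : Submodule ℂ V := Submodule.span ℂ (Set.range q.1) with hT₀
  have hT₀ : Module.finrank ℂ T₀ = p := by
    rw [hT₀, finrank_span_eq_card hqu.linearIndependent, Fintype.card_fin]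
  obtain ⟨k, hk⟩ := h T₀ hT₀
  have hmem : ∑ i, q.2 k i • q.1 i ∈ LinearMap.ker (ℓ k : V →ₗ[ℂ] F) ⊓ T₀ := by
    refine Submodule.mem_inf.2 ⟨?_, ?_⟩
    · rw [LinearMap.mem_ker, ContinuousLinearMap.coe_coe]
      exact hkill k
    · exact Submodule.sum_mem _ fun i _ => Submodule.smul_mem _ _ (Submodule.subset_span ⟨i, rfl⟩)
  rw [hk, Submodule.mem_bot] at hmem
  have hqk : q.2 k ≠ 0 := by
    intro h0
    have := hqc k (mem_univ k)
    rw [h0] at this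
    simp at this
  exact frameCombination_ne_zero hqu hqk hmem

end Literature.Geometry.Kaehler
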